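import Literature.MathematicalPhysics.QuantumFieldTheory.Balaban1983to89.T4ComplexDilation

/-!
# NE9BirthInsertion — the BIRTH line of route P3 for the spine estimate NE9 (node U3, cell `pub-balaban`, rung (B)+1 on a
finite T⁴), kernel-checked on the ONE-BLOCK MODEL of the tree leaf `T4ComplexDilation` at REAL coupling: the derivative of
a cut-off Boltzmann block integral in its own coupling is an INSERTION of the action density, dominated by the
absolute-value functional of the SAME block at a slightly DILATED REAL coupling — no complex coupling, no moving cut-off,
no shell term (BINDER row NE9 co-owner #3, unit `b2b-balaban-t4-ne9-p3`; skeleton `HOME/t4/skeletons/NE9-t4-ne9-p3.md`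
leaf L4 / item F-P3-1)

HONEST FRAMING (T4-DAG PAGE 1).  Rung (B)+1 on a FIXED finite torus; NOT infinite volume, NOT the mass gap, NOT Clay.  NE9
is NOT PRINTED.  This module is OUR OWN WORK (Summits side): elementary real analysis and measure theory on the abstract
one-block objects DEFINED in `T4ComplexDilation` (reference measure `μ` carrying the cut-off, coupling-free density `f`,
real action density `S ≥ 0` multiplied by the coupling, Gaussian normalisation `gaussNorm A`); it asserts NOTHING about
Bałaban's functionals and does NOT discharge NE9 (spine 0/9 unchanged).  The manuscripts under audit are named for
STRUCTURE only: in the UNSCALED fluctuation variables B′ of [Balaban1987RG1] (2.10) p. 267 every dependence on the step's own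
coupling is the prefactor `t_k = 1/g_k²` of the fluctuation action (LINEAR in the exponent) and the small-field cut-off (2.9)
p. 266 «χ_k = Π χ({|B′(b)| < ε₁})» is `t_k`-free — so `∂_{t_k}` of the step integral is an insertion, which is what is
modelled here.  (ABSOLUTE RULE: nothing printed is used as a hypothesis; every declaration is [folklore].)

WHAT IS PROVED (model letters of `T4ComplexDilation`: `blockInt μ f S w = ∫ f·e^{−wS} dμ`, `gaussNorm A w`, `invNorm A z`,
`absAct A μ f S r = ‖N_A(r)‖⁻¹·∫‖f‖e^{−rS}dμ` = the REAL absolute-value functional that printed-type bounds control).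
* §1 INSERTION WEIGHT: `r·s·e^{−rs} ≤ (eθ)⁻¹·e^{−(1−θ)rs}` for `s ≥ 0`, `θ > 0` (from `x + 1 ≤ eˣ`).
* §2 REAL DERIVATIVE = INSERTION: `r ↦ blockInt μ f S r` (real `r`) has derivative `∫ f·(−S)·e^{−rS} dμ` (the tree's complex
  `hasDerivAt_blockInt` restricted to the real axis), and the insertion is DOMINATED:
  `‖r·∫ f·(−S)e^{−rS}dμ‖ ≤ (eθ)⁻¹·∫‖f‖e^{−(1−θ)rS}dμ` (`S ≥ 0`, `0 < θ ≤ 1`, `r > 0`) — the absolute block integral at the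
  DILATED REAL coupling `(1−θ)r` (in g-currency: `g_k ↦ g_k/√(1−θ)`, the real twin of the sibling route's `(1+c)ε₁`).
* §3 VOLUME FACTOR AT REAL DILATION: `‖N_A((1−θ)r)‖ = (1−θ)^{−n/2}·‖N_A(r)‖` exactly (from the tree's branch-free
  `norm_gaussNorm_sq_mul`), hence the NORMALISED insertion bound
  `‖P_A(r)‖·‖r·I′(r)‖ ≤ (eθ)⁻¹·(1−θ)^{−n/2}·absAct((1−θ)r)` — volume factor `(1−θ)^{−n/2} ≤ e^{nθ/(2(1−θ))}`, the shape
  «exponential of (small parameter) × (number of variables)» of the complex face (`T4ComplexDilation.norm_act_le`).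
* §4 LOG-CURRENCY: `u ↦ blockInt μ f S (e^u)` has derivative `e^u·I′(e^u)` — the derivative in `u = log t` IS the relative
  insertion `t·∂_t`, so the §2–§3 bounds are UNIFORM-in-`u` derivative bounds (the currency of leaf L2 of the skeleton).
WHAT IS NOT HERE: the localized step of [Balaban1988RG2Cluster] §2 (the insertion run through (2.15)→(2.38) with the volume
factor absorbed by (2.30)) — skeleton item O2; the Gaussian normalisation's own factor `r^{n/2}` (logarithmic derivative `n/2`,
background-independent, cancelled by the normalisation (2.14) «log N_k″ = 𝐄^{(k+1)}(g_k, 1)») is displayed, not modelled.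

References (STRUCTURE only): T. Bałaban, CMP **109** (1987) 249–301 [Balaban1987RG1], (2.9)–(2.14) pp. 266–268;
T. Bałaban, CMP **116** (1988) 1–22 [Balaban1988RG2Cluster], (2.15) p. 15, (2.30) p. 18.
-/

noncomputable section

namespace Summit.QuantumFields.BalabanUV.T4Continuum.NE9BirthInsertion

open MeasureTheory Complex
open Literature.MathematicalPhysics.QuantumFieldTheory.Balaban1983to89.T4ComplexDilation

/-! ## §1 The insertion weight -/

/-- `y·e^{−θy} ≤ (eθ)⁻¹` for `θ > 0` (any real `y`): from `x + 1 ≤ eˣ` at `x = θy − 1`. [folklore] -/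
theorem mul_exp_neg_mul_le {θ : ℝ} (hθ : 0 < θ) (y : ℝ) : y * Real.exp (-(θ * y)) ≤ (Real.exp 1 * θ)⁻¹ := by
  have h := Real.add_one_le_exp (θ * y - 1)
  have he : Real.exp (θ * y - 1) = Real.exp (θ * y) / Real.exp 1 := by rw [Real.exp_sub]
  rw [he] at h
  have h1 : θ * y ≤ Real.exp (θ * y) / Real.exp 1 := by linarith
  have key : θ * (y * Real.exp (-(θ * y))) ≤ (Real.exp 1)⁻¹ := by
    have h2 : θ * y * Real.exp (-(θ * y)) ≤ Real.exp (θ * y) / Real.exp 1 * Real.exp (-(θ * y)) :=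
      mul_le_mul_of_nonneg_right h1 (Real.exp_nonneg _)
    have e : Real.exp (θ * y) / Real.exp 1 * Real.exp (-(θ * y)) = (Real.exp 1)⁻¹ := by
      rw [Real.exp_neg]; field_simp
    rw [e] at h2
    linarith
  calc y * Real.exp (-(θ * y)) = θ⁻¹ * (θ * (y * Real.exp (-(θ * y)))) := by field_simp
    _ ≤ θ⁻¹ * (Real.exp 1)⁻¹ := mul_le_mul_of_nonneg_left key (inv_nonneg.2 hθ.le)
    _ = (Real.exp 1 * θ)⁻¹ := by rw [mul_inv, mul_comm]

/-- **THE INSERTION WEIGHT**: `r·s·e^{−rs} ≤ (eθ)⁻¹·e^{−(1−θ)rs}` for `θ > 0` (split `e^{−rs} = e^{−θrs}·e^{−(1−θ)rs}` and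
bound `rs·e^{−θrs}`): an insertion of the action density costs `(eθ)⁻¹` and a DILATION of the real coupling by `(1 − θ)`.
[folklore] -/
theorem insertionWeight_le {θ : ℝ} (hθ : 0 < θ) (r s : ℝ) :
    r * s * Real.exp (-(r * s)) ≤ (Real.exp 1 * θ)⁻¹ * Real.exp (-((1 - θ) * r * s)) := by
  have h := mul_exp_neg_mul_le hθ (r * s)
  have hsplit : Real.exp (-(r * s)) = Real.exp (-(θ * (r * s))) * Real.exp (-((1 - θ) * r * s)) := by
    rw [← Real.exp_add]; ring_nf
  rw [hsplit, ← mul_assoc]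
  exact mul_le_mul_of_nonneg_right h (Real.exp_nonneg _)

/-! ## §2 The real derivative of the block integral is the insertion, and the insertion is dominated -/

section Block

variable {X : Type*} [MeasurableSpace X] (μ : Measure X)

/-- The INSERTION integral `∫ f·(−S)·e^{−rS} dμ` at real coupling `r` (the derivative of the block integral, below).
[folklore] -/
def insertion (f : X → ℂ) (S : X → ℝ) (r : ℝ) : ℂ := ∫ x, f x * (-(S x : ℂ) * cexp (-((r : ℂ) * S x))) ∂μ

/-- **REAL DERIVATIVE = INSERTION**: `r ↦ ∫ f e^{−rS} dμ` (real `r`; `f` integrable, `S` measurable and bounded on the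
block) has derivative `∫ f·(−S)·e^{−rS} dμ` — the tree's holomorphy statement `hasDerivAt_blockInt` restricted to the real
axis (`HasDerivAt.comp_ofReal`).  No complex coupling is used beyond that restriction. [folklore] -/
theorem hasDerivAt_blockInt_real {f : X → ℂ} (hf : Integrable f μ) {S : X → ℝ} (hS : Measurable S) {S₀ : ℝ}
    (hS₀ : ∀ x, |S x| ≤ S₀) (r : ℝ) :
    HasDerivAt (fun r : ℝ => blockInt μ f S (r : ℂ)) (insertion μ f S r) r :=
  (hasDerivAt_blockInt μ hf hS hS₀ (r : ℂ)).comp_ofReal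

omit [MeasurableSpace X] in
/-- Pointwise domination of the `r`-weighted insertion integrand (`S ≥ 0`, `θ > 0`):
`‖f·(−rS)·e^{−rS}‖ ≤ (eθ)⁻¹·‖f‖·e^{−(1−θ)rS}`. [folklore] -/
theorem norm_weighted_insertion_integrand_le {f : X → ℂ} {S : X → ℝ} (hS : ∀ x, 0 ≤ S x) {θ : ℝ} (hθ : 0 < θ)
    {r : ℝ} (hr : 0 ≤ r) (x : X) :
    ‖(r : ℂ) * (f x * (-(S x : ℂ) * cexp (-((r : ℂ) * S x))))‖ ≤
      (Real.exp 1 * θ)⁻¹ * (‖f x‖ * Real.exp (-((1 - θ) * r * S x))) := by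
  have hcexp : ‖cexp (-((r : ℂ) * S x))‖ = Real.exp (-(r * S x)) := by
    rw [Complex.norm_exp]
    congr 1
    simp [Complex.neg_re, Complex.mul_re]
  rw [norm_mul, norm_mul, norm_mul, norm_neg, Complex.norm_real, Complex.norm_real, hcexp,
    Real.norm_of_nonneg hr, Real.norm_of_nonneg (hS x)]
  have key := insertionWeight_le hθ r (S x)
  calc r * (‖f x‖ * (S x * Real.exp (-(r * S x)))) = ‖f x‖ * (r * S x * Real.exp (-(r * S x))) := by ring
    _ ≤ ‖f x‖ * ((Real.exp 1 * θ)⁻¹ * Real.exp (-((1 - θ) * r * S x))) :=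
        mul_le_mul_of_nonneg_left key (norm_nonneg _)
    _ = (Real.exp 1 * θ)⁻¹ * (‖f x‖ * Real.exp (-((1 - θ) * r * S x))) := by ring

/-- **THE INSERTION IS DOMINATED by the absolute block integral at the dilated real coupling**:
`‖r·∫ f·(−S)e^{−rS}dμ‖ ≤ (eθ)⁻¹·∫‖f‖e^{−(1−θ)rS}dμ` (`S ≥ 0`, `0 < θ ≤ 1`, `r ≥ 0`, `f` integrable, `S` measurable).
[folklore] -/
theorem norm_mul_insertion_le {f : X → ℂ} (hf : Integrable f μ) {S : X → ℝ} (hSm : Measurable S)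
    (hS : ∀ x, 0 ≤ S x) {θ : ℝ} (hθ : 0 < θ) (hθ1 : θ ≤ 1) {r : ℝ} (hr : 0 ≤ r) :
    ‖(r : ℂ) * insertion μ f S r‖ ≤
      (Real.exp 1 * θ)⁻¹ * ∫ x, ‖f x‖ * Real.exp (-((1 - θ) * r * S x)) ∂μ := by
  unfold insertion
  rw [← integral_const_mul, ← integral_const_mul]
  refine norm_integral_le_of_norm_le ?_ (Filter.Eventually.of_forall fun x => ?_)
  · -- the dominating function is integrable: it is bounded by a constant multiple of ‖f‖
    refine Integrable.const_mul ?_ _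
    refine Integrable.mono' hf.norm ?_ (Filter.Eventually.of_forall fun x => ?_)
    · refine hf.norm.aestronglyMeasurable.mul ?_
      have hc : Continuous fun a : ℝ => Real.exp (-((1 - θ) * r * a)) := by fun_prop
      exact (hc.measurable.comp hSm).aestronglyMeasurable
    · rw [Real.norm_of_nonneg (mul_nonneg (norm_nonneg _) (Real.exp_nonneg _))]
      refine mul_le_of_le_one_right (norm_nonneg _) ?_
      rw [Real.exp_le_one_iff]
      have : 0 ≤ (1 - θ) * r * S x := mul_nonneg (mul_nonneg (by linarith) hr) (hS x)
      linarith
  · exact norm_weighted_insertion_integrand_le hS hθ hr x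

end Block

/-! ## §3 The volume factor at a REAL dilation and the normalised insertion bound -/

section Normalised

variable {ι : Type*} [Fintype ι] [DecidableEq ι] {X : Type*} [MeasurableSpace X]

/-- **VOLUME FACTOR AT REAL DILATION, exact**: `‖N_A((1−θ)r)‖²·(1−θ)ⁿ = ‖N_A(r)‖²` for `A ≻ 0`, `r > 0`, `θ < 1` — the
Gaussian normalisation at the dilated real coupling is `(1−θ)^{−n/2}` times the undilated one (tree
`norm_gaussNorm_sq_mul`: `‖N_A(w)‖²‖w‖ⁿ det A = (2π)ⁿ`). [folklore] -/
theorem norm_gaussNorm_dilate_sq (A : Matrix ι ι ℝ) (hA : A.PosDef) {r θ : ℝ} (hr : 0 < r) (hθ : θ < 1) :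
    ‖gaussNorm A (((1 - θ) * r : ℝ) : ℂ)‖ ^ 2 * (1 - θ) ^ Fintype.card ι = ‖gaussNorm A (r : ℂ)‖ ^ 2 := by
  set n := Fintype.card ι
  have h1θ : 0 < 1 - θ := by linarith
  have hw1 : 0 < ((r : ℝ) : ℂ).re := by simpa using hr
  have hw2 : 0 < ((((1 - θ) * r : ℝ)) : ℂ).re := by
    simp only [Complex.ofReal_re]; positivity
  have e1 := norm_gaussNorm_sq_mul A hA hw1
  have e2 := norm_gaussNorm_sq_mul A hA hw2
  rw [Complex.norm_real, Real.norm_of_nonneg hr.le] at e1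
  rw [Complex.norm_real, Real.norm_of_nonneg (by positivity : (0:ℝ) ≤ (1 - θ) * r), mul_pow] at e2
  have hdet : 0 < A.det := hA.det_pos
  have hrn : 0 < r ^ n := pow_pos hr n
  -- cancel the common positive factor `rⁿ·det A`
  have : ‖gaussNorm A (((1 - θ) * r : ℝ) : ℂ)‖ ^ 2 * (1 - θ) ^ n * (r ^ n * A.det) =
      ‖gaussNorm A (r : ℂ)‖ ^ 2 * (r ^ n * A.det) := by
    calc ‖gaussNorm A (((1 - θ) * r : ℝ) : ℂ)‖ ^ 2 * (1 - θ) ^ n * (r ^ n * A.det)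
        = ‖gaussNorm A (((1 - θ) * r : ℝ) : ℂ)‖ ^ 2 * ((1 - θ) ^ n * r ^ n * A.det) := by ring
      _ = (2 * Real.pi) ^ n := e2
      _ = ‖gaussNorm A (r : ℂ)‖ ^ 2 * (r ^ n * A.det) := e1.symm
  exact mul_right_cancel₀ (mul_pos hrn hdet).ne' this

/-- The inverse normalisations: `‖N_A(r)‖⁻¹ = (1−θ)^{−n/2}·‖N_A((1−θ)r)‖⁻¹` with `(1−θ)^{−n/2} = √((1−θ)ⁿ)⁻¹`.
[folklore] -/
theorem inv_norm_gaussNorm_eq_dilate (A : Matrix ι ι ℝ) (hA : A.PosDef) {r θ : ℝ} (hr : 0 < r) (hθ : θ < 1) :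
    ‖gaussNorm A (r : ℂ)‖⁻¹ =
      Real.sqrt (((1 - θ) ^ Fintype.card ι)⁻¹) * ‖gaussNorm A (((1 - θ) * r : ℝ) : ℂ)‖⁻¹ := by
  set n := Fintype.card ι
  have h1θ : 0 < (1 - θ) ^ n := pow_pos (by linarith) n
  have hsq := norm_gaussNorm_dilate_sq A hA hr hθ
  have hN1 : 0 ≤ ‖gaussNorm A (r : ℂ)‖ := norm_nonneg _
  have hN2 : 0 ≤ ‖gaussNorm A (((1 - θ) * r : ℝ) : ℂ)‖ := norm_nonneg _
  have hroot : ‖gaussNorm A (r : ℂ)‖ = ‖gaussNorm A (((1 - θ) * r : ℝ) : ℂ)‖ * Real.sqrt ((1 - θ) ^ n) := by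
    have : ‖gaussNorm A (r : ℂ)‖ ^ 2 = (‖gaussNorm A (((1 - θ) * r : ℝ) : ℂ)‖ * Real.sqrt ((1 - θ) ^ n)) ^ 2 := by
      rw [mul_pow, Real.sq_sqrt h1θ.le, hsq]
    exact (pow_left_inj₀ hN1 (mul_nonneg hN2 (Real.sqrt_nonneg _)) two_ne_zero).1 this
  rw [hroot, mul_inv, Real.sqrt_inv, mul_comm]

/-- **THE NORMALISED INSERTION BOUND (birth line of route P3 on the model)**: for `A ≻ 0`, `S ≥ 0` bounded measurable,
`f` integrable, `0 < θ < 1`, `r > 0`: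
`‖P_A(r)‖·‖r·∫ f(−S)e^{−rS}dμ‖ ≤ (eθ)⁻¹·(1−θ)^{−n/2}·absAct A μ f S ((1−θ)r)` — the derivative of the normalised block
activity's numerator in its own coupling, read against the normalisation at `r`, is the absolute-value functional of the
SAME block at the dilated REAL coupling `(1−θ)r`, times the insertion cost `(eθ)⁻¹` and the volume factor `(1−θ)^{−n/2}`.
No complex coupling, no moving cut-off (the cut-off sits in `μ`/`f`, coupling-free), hence no shell term. [folklore] -/
theorem norm_invNorm_mul_insertion_le (A : Matrix ι ι ℝ) (hA : A.PosDef) {μ : Measure X} {f : X → ℂ}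
    (hf : Integrable f μ) {S : X → ℝ} (hSm : Measurable S) (hS : ∀ x, 0 ≤ S x) {θ : ℝ} (hθ : 0 < θ) (hθ1 : θ < 1)
    {r : ℝ} (hr : 0 < r) :
    ‖invNorm A (r : ℂ)‖ * ‖(r : ℂ) * insertion μ f S r‖ ≤
      (Real.exp 1 * θ)⁻¹ * Real.sqrt (((1 - θ) ^ Fintype.card ι)⁻¹) * absAct A μ f S ((1 - θ) * r) := by
  have hre : 0 < ((r : ℝ) : ℂ).re := by simpa using hr
  rw [norm_invNorm_eq_inv A hA hre, inv_norm_gaussNorm_eq_dilate A hA hr hθ1]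
  have hins := norm_mul_insertion_le μ hf hSm hS hθ hθ1.le hr.le
  have hV : 0 ≤ Real.sqrt (((1 - θ) ^ Fintype.card ι)⁻¹) := Real.sqrt_nonneg _
  have hNinv : 0 ≤ ‖gaussNorm A (((1 - θ) * r : ℝ) : ℂ)‖⁻¹ := inv_nonneg.2 (norm_nonneg _)
  unfold absAct
  have hint_eq : ∫ x, ‖f x‖ * Real.exp (-((1 - θ) * r * S x)) ∂μ =
      ∫ x, ‖f x‖ * Real.exp (-(((1 - θ) * r) * S x)) ∂μ := rfl
  calc Real.sqrt (((1 - θ) ^ Fintype.card ι)⁻¹) * ‖gaussNorm A (((1 - θ) * r : ℝ) : ℂ)‖⁻¹ *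
        ‖(r : ℂ) * insertion μ f S r‖
      ≤ Real.sqrt (((1 - θ) ^ Fintype.card ι)⁻¹) * ‖gaussNorm A (((1 - θ) * r : ℝ) : ℂ)‖⁻¹ *
        ((Real.exp 1 * θ)⁻¹ * ∫ x, ‖f x‖ * Real.exp (-((1 - θ) * r * S x)) ∂μ) :=
        mul_le_mul_of_nonneg_left hins (mul_nonneg hV hNinv)
    _ = (Real.exp 1 * θ)⁻¹ * Real.sqrt (((1 - θ) ^ Fintype.card ι)⁻¹) *
        (‖gaussNorm A ((((1 - θ) * r : ℝ)) : ℂ)‖⁻¹ * ∫ x, ‖f x‖ * Real.exp (-(((1 - θ) * r) * S x)) ∂μ) := by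
        rw [hint_eq]; ring

/-- The volume factor at real dilation is at most `e^{nθ/(2(1−θ))}` — the shape «exponential of (small parameter) × (number
of variables)», absorbable against tree-length decay where volume ≍ linear size ([Balaban1988RG2Cluster] (2.30) TYPE).
[folklore] -/
theorem sqrt_inv_pow_le_exp {θ : ℝ} (hθ1 : θ < 1) (n : ℕ) :
    Real.sqrt (((1 - θ) ^ n)⁻¹) ≤ Real.exp (n * θ / (1 - θ) / 2) := by
  have h1θ : 0 < 1 - θ := by linarith
  -- (1-θ)⁻¹ ≤ exp(θ/(1-θ)) since 1 + θ/(1-θ) = (1-θ)⁻¹ ≤ exp(θ/(1-θ))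
  have hbase : (1 - θ)⁻¹ ≤ Real.exp (θ / (1 - θ)) := by
    have h := Real.add_one_le_exp (θ / (1 - θ))
    have e : θ / (1 - θ) + 1 = (1 - θ)⁻¹ := by field_simp; ring
    rwa [e] at h
  have hpow : ((1 - θ) ^ n)⁻¹ ≤ Real.exp (n * θ / (1 - θ)) := by
    rw [← inv_pow, show (n : ℝ) * θ / (1 - θ) = n * (θ / (1 - θ)) by ring, Real.exp_nat_mul]
    exact pow_le_pow_left₀ (inv_nonneg.2 h1θ.le) hbase n
  calc Real.sqrt (((1 - θ) ^ n)⁻¹) ≤ Real.sqrt (Real.exp (n * θ / (1 - θ))) := Real.sqrt_le_sqrt hpow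
    _ = Real.exp (n * θ / (1 - θ) / 2) := (Real.exp_half _).symm

end Normalised

/-! ## §4 Log-currency: the derivative in `u = log t` is the relative insertion `t·∂_t` -/

section Currency

variable {X : Type*} [MeasurableSpace X] (μ : Measure X)

/-- **LOG-CURRENCY**: `u ↦ ∫ f e^{−e^u S} dμ` has derivative `e^u · (insertion at e^u)` — so a bound on the RELATIVE insertion
`t·∂_t` (§2–§3) is a UNIFORM derivative bound in `u = log t`, the currency in which leaf L2 of the skeleton states the
one-coordinate moduli. [folklore] -/
theorem hasDerivAt_blockInt_log {f : X → ℂ} (hf : Integrable f μ) {S : X → ℝ} (hS : Measurable S) {S₀ : ℝ}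
    (hS₀ : ∀ x, |S x| ≤ S₀) (u : ℝ) :
    HasDerivAt (fun u : ℝ => blockInt μ f S (Real.exp u : ℂ))
      ((Real.exp u : ℂ) * insertion μ f S (Real.exp u)) u := by
  have h1 := hasDerivAt_blockInt_real μ hf hS hS₀ (Real.exp u)
  have h2 : HasDerivAt (fun u : ℝ => Real.exp u) (Real.exp u) u := Real.hasDerivAt_exp u
  have h := h1.scomp u h2
  rw [show ((Real.exp u : ℝ) : ℂ) * insertion μ f S (Real.exp u) = Real.exp u • insertion μ f S (Real.exp u) from
    (Complex.real_smul).symm]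
  exact h

/-- The uniform-in-`u` form of §2: `‖∂_u ∫ f e^{−e^u S}dμ‖ ≤ (eθ)⁻¹·∫‖f‖e^{−(1−θ)e^u S}dμ`. [folklore] -/
theorem norm_deriv_log_le {f : X → ℂ} (hf : Integrable f μ) {S : X → ℝ} (hSm : Measurable S)
    (hS : ∀ x, 0 ≤ S x) {θ : ℝ} (hθ : 0 < θ) (hθ1 : θ ≤ 1) (u : ℝ) :
    ‖(Real.exp u : ℂ) * insertion μ f S (Real.exp u)‖ ≤
      (Real.exp 1 * θ)⁻¹ * ∫ x, ‖f x‖ * Real.exp (-((1 - θ) * Real.exp u * S x)) ∂μ :=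
  norm_mul_insertion_le μ hf hSm hS hθ hθ1 (Real.exp_pos u).le

end Currency

end Summit.QuantumFields.BalabanUV.T4Continuum.NE9BirthInsertion

end
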